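import Literature.Topology.FourManifolds.GluingConstruction
import Mathlib.Geometry.Manifold.IsManifold.InteriorBoundary
import HarnessLib

/-!
# Gluing two manifolds with boundary along a partial diffeomorphism of open subsets

Topic `Literature/Topology/FourManifolds`, companion of `GluingConstruction.lean`. That file
constructs the smooth manifold `A ∪_ψ B` obtained by gluing two *boundaryless* manifolds along a
partial diffeomorphism `ψ` of open subsets (Kosinski, *Differential Manifolds* (1993), VI.1 and
I.(5.1)), as the quotient `d.Glued` of `A ⊕ B` attached to a `SmoothGlueData`; its smooth
structure (`instChartedSpace`, `instIsManifold`, modelled on the vector space `E_P`) uses that the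
models of the pieces are boundaryless. Here the same topological gluing `d.Glued` — for a gluing
datum `d : SmoothGlueData (𝓡∂ (n + 1)) (𝓡∂ (n + 1)) A B ℝⁿ⁺¹` of two manifolds *with boundary*,
both modelled on the half-space `𝓡∂ (n + 1)` — is given the structure of a `C^∞` manifold with
boundary modelled on `𝓡∂ (n + 1)`: the atlas consists of the lifts along `inl`, `inr` of all charts
of the maximal atlases of the pieces (`chartAH`, `chartBH`, `instChartedSpaceH`), and changes of
charts across the pieces are conjugates of the gluing map, smooth for `𝓡∂ (n + 1)`
(`contDiffOn_lift_symm_trans_lift_self`, `instIsManifoldH`). As in the boundaryless case,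
`inl ∘ g` is an immersion / smooth embedding where `g` is (`isImmersionAtOfComplement_inl_compH`,
`isSmoothEmbedding_inlH`, …), and the boundary of the glued manifold is the union of the images of
the boundaries of the pieces (`isBoundaryPoint_inl_iff`, `boundary_glued_eq`). This is the
operation by which manifolds with boundary are assembled from pieces in Kervaire–Milnor, *Groups of
homotopy spheres I* (1963): §2, proof of Lemma 2.2 (`W₁ + M₂ × [0, 1]` glued along `ℝⁿ × [0, 1]`),
proof of Lemma 2.4 (`(M - i(½Dⁿ)) × [0, π] + Sⁿ⁻¹ × H²`), the Addendum (boundary connected sum),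
and Milnor, *Lectures on the h-cobordism theorem* (1965), §1 (Thm. 1.4: gluing cobordisms).

## Main results

* `Literature.Topology.FourManifolds.contDiffOn_of_contMDiffOn_self`: a `ContMDiffOn I I` map of the model space `H`, read
  through `I`, is `ContDiffOn` on the corresponding subset of `range I` (the compatibility
  condition of `contDiffGroupoid`).
* `Literature.Topology.FourManifolds.contDiffOn_lift_symm_trans_lift_self`: change of lifted maximal-atlas charts across an
  overlap governed by a `C^∞` partial map, for pieces and result with the *same* model `I`.
* `Literature.Topology.FourManifolds.SmoothGlueData.instChartedSpaceH`, `instIsManifoldH`, `isSmoothEmbedding_inlH/inrH`,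
  `isSmoothEmbedding_inl_compH/inr_compH`, `contMDiff_inlH/inrH`, `isBoundaryPoint_inl_iff`,
  `isBoundaryPoint_inr_iff`, `boundary_glued_eq`.

## References

* A. Kosinski, *Differential Manifolds*, Academic Press (1993), Ch. VI §1, Ch. I (5.1).
  [Kosinski1993]
* M. Kervaire, J. Milnor, *Groups of homotopy spheres I*, Ann. of Math. 77 (1963), §2.
  [KervaireMilnorAnnals1963]
* J. Milnor, *Lectures on the h-cobordism theorem* (1965), §1, Thm. 1.4. [MilnorHCobordism1965]
-/

open scoped Manifold ContDiff Topology
open Set Function OpenPartialHomeomorph Topology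

noncomputable section

namespace Literature.Topology.FourManifolds

universe uA uB

/-- Local notation: `𝔼 n` is the model Euclidean space `EuclideanSpace ℝ (Fin n)`. -/
local notation "𝔼 " n:arg => EuclideanSpace ℝ (Fin n)
/-- Local notation: `ℍ n` is the model half-space `EuclideanHalfSpace n`. -/
local notation "ℍ " n:arg => EuclideanHalfSpace n

/-! ### `ContMDiffOn` on the model space, read as `ContDiffOn` through the model -/

section ModelSpace

variable {E H : Type*} [NormedAddCommGroup E] [NormedSpace ℝ E] [TopologicalSpace H]
  (I : ModelWithCorners ℝ E H) {m : WithTop ℕ∞}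

/-- A map `F : H → H` of the model space which is `ContMDiffWithinAt I I` is, read through the
model `I`, `ContDiffWithinAt` within the corresponding subset of `range I` (this is the unfolding
of `contMDiffWithinAt_iff` on the model space, whose extended charts are `I` itself). [folklore] -/
theorem contDiffWithinAt_of_contMDiffWithinAt_self {F : H → H} {s : Set H} {x : H}
    (h : ContMDiffWithinAt I I m F s x) :
    ContDiffWithinAt ℝ m (I ∘ F ∘ I.symm) (I.symm ⁻¹' s ∩ range I) (I x) :=
  (contMDiffWithinAt_iff.1 h).2

/-- A `ContMDiffOn I I` map of the model space, read through `I`, is `ContDiffOn` on the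
corresponding subset of `range I` — the compatibility condition defining `contDiffGroupoid`.
[folklore] -/
theorem contDiffOn_of_contMDiffOn_self {F : H → H} {s : Set H} (h : ContMDiffOn I I m F s) :
    ContDiffOn ℝ m (I ∘ F ∘ I.symm) (I.symm ⁻¹' s ∩ range I) := by
  rintro u ⟨hu, ⟨x, rfl⟩⟩
  rw [mem_preimage, I.left_inv] at hu
  exact contDiffWithinAt_of_contMDiffWithinAt_self I (h x hu)

end ModelSpace

/-! ### Change of lifted charts (pieces and result with the same model) -/

section LiftCompatSelf

variable {E H : Type*} [NormedAddCommGroup E] [NormedSpace ℝ E] [TopologicalSpace H] [Nonempty H]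
  {I : ModelWithCorners ℝ E H} {M : Type*} [TopologicalSpace M] [ChartedSpace H M]
  {M' : Type*} [TopologicalSpace M'] [ChartedSpace H M'] {P : Type*} [TopologicalSpace P]

/-- **Change of lifted charts, same model.** Let `i : M → P`, `i' : M' → P` be open embeddings of
two charted spaces (model `I` on `H`, possibly with boundary) into a space `P` whose overlap is
governed by a `C^∞` partial map `θ : M ⇀ M'` (`i m = i' m' ↔ m ∈ θ.source ∧ θ m = m'`). Then for
charts `f`, `f'` of the maximal `C^∞` atlases of `M`, `M'`, the change of charts between the lifted
charts `f.lift i` and `f'.lift i'` of `P` satisfies the compatibility condition of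
`contDiffGroupoid ∞ I`: on its source it is `f' ∘ θ ∘ f.symm`, which is `ContMDiffOn I I`
(Kosinski, *Differential Manifolds*, VI.1 / I.(5.1)). [folklore] -/
theorem contDiffOn_lift_symm_trans_lift_self {i : M → P} (hi : IsOpenEmbedding i) {i' : M' → P}
    (hi' : IsOpenEmbedding i') (θ : OpenPartialHomeomorph M M')
    (hθ : ContMDiffOn I I ∞ θ θ.source) (hcompat : ∀ m m', i m = i' m' ↔ m ∈ θ.source ∧ θ m = m')
    {f : OpenPartialHomeomorph M H} (hf : f ∈ IsManifold.maximalAtlas I ∞ M)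
    {f' : OpenPartialHomeomorph M' H} (hf' : f' ∈ IsManifold.maximalAtlas I ∞ M') :
    ContDiffOn ℝ ∞
      (I ∘ ((f.lift_openEmbedding hi).symm ≫ₕ f'.lift_openEmbedding hi') ∘ I.symm)
      (I.symm ⁻¹' ((f.lift_openEmbedding hi).symm ≫ₕ f'.lift_openEmbedding hi').source ∩
        range I) := by
  set e := f.lift_openEmbedding hi
  set e' := f'.lift_openEmbedding hi'
  apply contDiffOn_of_contMDiffOn_self I
  -- the honest formula and its domain
  set F : H → H := f' ∘ θ ∘ f.symm with hF
  set S : Set H := {u | u ∈ f.target ∧ f.symm u ∈ θ.source ∧ θ (f.symm u) ∈ f'.source} with hS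
  have hsub : (e.symm ≫ₕ e').source ⊆ S := by
    intro u hu
    simp only [trans_source, mem_inter_iff, mem_preimage, e, e', lift_openEmbedding_source,
      symm_source, lift_openEmbedding_target, lift_openEmbedding_symm, comp_apply] at hu
    obtain ⟨hu1, m', hm', hmm'⟩ := hu
    obtain ⟨hm, rfl⟩ := (hcompat _ _).1 hmm'.symm
    exact ⟨hu1, hm, hm'⟩
  have heq : EqOn (e.symm ≫ₕ e') F (e.symm ≫ₕ e').source := by
    intro u hu
    simp only [trans_source, mem_inter_iff, mem_preimage, e, e', lift_openEmbedding_source,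
      symm_source, lift_openEmbedding_target, lift_openEmbedding_symm, comp_apply] at hu
    obtain ⟨-, m', -, hmm'⟩ := hu
    obtain ⟨hm, rfl⟩ := (hcompat _ _).1 hmm'.symm
    simp only [coe_trans, comp_apply, e, e', lift_openEmbedding_symm, hF]
    rw [hmm'.symm, lift_openEmbedding_apply]
  refine ContMDiffOn.congr (ContMDiffOn.mono ?_ hsub) heq
  have h2 : ContMDiffOn I I ∞ f.symm S :=
    (contMDiffOn_symm_of_mem_maximalAtlas hf).mono fun u hu => hu.1
  have h3 : ContMDiffOn I I ∞ (θ ∘ f.symm) S := hθ.comp h2 fun u hu => hu.2.1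
  exact (contMDiffOn_of_mem_maximalAtlas hf').comp h3 fun u hu => hu.2.2

end LiftCompatSelf

/-! ### The smooth structure with boundary on a gluing of two manifolds with boundary -/

namespace SmoothGlueData

variable {n : ℕ} {A : Type uA} [TopologicalSpace A] [ChartedSpace (ℍ (n + 1)) A]
  {B : Type uB} [TopologicalSpace B] [ChartedSpace (ℍ (n + 1)) B]
  (d : SmoothGlueData (𝓡∂ (n + 1)) (𝓡∂ (n + 1)) A B (𝔼 (n + 1)))

/-- The chart of the glued space obtained from a chart `e` of the piece `A` (both valued in the
half-space `ℍⁿ⁺¹`): on `inl '' e.source` it is `e ∘ inl⁻¹` (Kosinski, VI.1). [folklore] -/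
def chartAH (e : OpenPartialHomeomorph A (ℍ (n + 1))) : OpenPartialHomeomorph d.Glued (ℍ (n + 1)) :=
  e.lift_openEmbedding d.isOpenEmbedding_inl

/-- The source of `chartAH e` is `inl '' e.source`. [folklore] -/
@[simp] theorem chartAH_source (e : OpenPartialHomeomorph A (ℍ (n + 1))) :
    (d.chartAH e).source = d.inl '' e.source := rfl

/-- `chartAH e (inl a) = e a`. [folklore] -/
@[simp] theorem chartAH_apply_inl (e : OpenPartialHomeomorph A (ℍ (n + 1))) (a : A) :
    d.chartAH e (d.inl a) = e a := by
  rw [chartAH, lift_openEmbedding_apply]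

/-- The chart of the glued space obtained from a chart `e` of the piece `B`. [folklore] -/
def chartBH (e : OpenPartialHomeomorph B (ℍ (n + 1))) : OpenPartialHomeomorph d.Glued (ℍ (n + 1)) :=
  e.lift_openEmbedding d.isOpenEmbedding_inr

/-- The source of `chartBH e` is `inr '' e.source`. [folklore] -/
@[simp] theorem chartBH_source (e : OpenPartialHomeomorph B (ℍ (n + 1))) :
    (d.chartBH e).source = d.inr '' e.source := rfl

/-- `chartBH e (inr b) = e b`. [folklore] -/
@[simp] theorem chartBH_apply_inr (e : OpenPartialHomeomorph B (ℍ (n + 1))) (b : B) :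
    d.chartBH e (d.inr b) = e b := by
  rw [chartBH, lift_openEmbedding_apply]

variable [IsManifold (𝓡∂ (n + 1)) ∞ A] [IsManifold (𝓡∂ (n + 1)) ∞ B]

/-- **The glued space of two manifolds with boundary as a charted space on the half-space**:
the atlas consists of the lifts of all charts in the maximal `C^∞` atlases of the two pieces
(Kosinski, *Differential Manifolds*, VI.1). An instance: the boundaryless-case instance
`instChartedSpace` of `GluingConstruction.lean` (charts valued in the model vector space, requiring
boundaryless piece models) does not apply to pieces modelled on `𝓡∂ (n + 1)`. [folklore] -/
instance instChartedSpaceH : ChartedSpace (ℍ (n + 1)) d.Glued where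
  atlas := d.chartAH '' IsManifold.maximalAtlas (𝓡∂ (n + 1)) ∞ A ∪
    d.chartBH '' IsManifold.maximalAtlas (𝓡∂ (n + 1)) ∞ B
  chartAt p := by
    classical
    exact if h : ∃ a, d.inl a = p then d.chartAH (chartAt (ℍ (n + 1)) (Classical.choose h))
      else d.chartBH (chartAt (ℍ (n + 1)) (Classical.choose ((d.exists_inl_or_inr p).resolve_left h)))
  mem_chart_source p := by
    by_cases h : ∃ a, d.inl a = p
    · simp only [h, ↓reduceDIte, chartAH_source]
      exact ⟨_, mem_chart_source _ _, Classical.choose_spec h⟩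
    · simp only [h, ↓reduceDIte, chartBH_source]
      exact ⟨_, mem_chart_source _ _,
        Classical.choose_spec ((d.exists_inl_or_inr p).resolve_left h)⟩
  chart_mem_atlas p := by
    by_cases h : ∃ a, d.inl a = p
    · simp only [h, ↓reduceDIte]
      exact Or.inl ⟨_, IsManifold.chart_mem_maximalAtlas _, rfl⟩
    · simp only [h, ↓reduceDIte]
      exact Or.inr ⟨_, IsManifold.chart_mem_maximalAtlas _, rfl⟩

/-- Description of the atlas of the glued space (with boundary). [folklore] -/
theorem mem_atlasH_iff {e : OpenPartialHomeomorph d.Glued (ℍ (n + 1))} :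
    e ∈ atlas (ℍ (n + 1)) d.Glued ↔
      (∃ f ∈ IsManifold.maximalAtlas (𝓡∂ (n + 1)) ∞ A, d.chartAH f = e) ∨
      ∃ f ∈ IsManifold.maximalAtlas (𝓡∂ (n + 1)) ∞ B, d.chartBH f = e :=
  Iff.rfl

/-- Lifts of maximal-atlas charts of `A` are charts of the glued space. [folklore] -/
theorem chartAH_mem_atlas {f : OpenPartialHomeomorph A (ℍ (n + 1))}
    (hf : f ∈ IsManifold.maximalAtlas (𝓡∂ (n + 1)) ∞ A) : d.chartAH f ∈ atlas (ℍ (n + 1)) d.Glued :=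
  Or.inl ⟨f, hf, rfl⟩

/-- Lifts of maximal-atlas charts of `B` are charts of the glued space. [folklore] -/
theorem chartBH_mem_atlas {f : OpenPartialHomeomorph B (ℍ (n + 1))}
    (hf : f ∈ IsManifold.maximalAtlas (𝓡∂ (n + 1)) ∞ B) : d.chartBH f ∈ atlas (ℍ (n + 1)) d.Glued :=
  Or.inr ⟨f, hf, rfl⟩

/-- **The glued space of two manifolds with boundary is a smooth manifold with boundary**
(model `𝓡∂ (n + 1)`): changes of charts within one piece are changes of maximal-atlas charts,
and across the pieces they are conjugates of the smooth gluing map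
(`contDiffOn_lift_symm_trans_lift_self`; Kosinski, *Differential Manifolds*, VI.1). [folklore] -/
instance instIsManifoldH : IsManifold (𝓡∂ (n + 1)) ∞ d.Glued := by
  refine isManifold_of_contDiffOn _ _ _ ?_
  rintro e e' (⟨f, hf, rfl⟩ | ⟨f, hf, rfl⟩) (⟨f', hf', rfl⟩ | ⟨f', hf', rfl⟩)
  · exact contDiffOn_lift_symm_trans_lift_self d.isOpenEmbedding_inl d.isOpenEmbedding_inl
      (OpenPartialHomeomorph.refl A) contMDiff_id.contMDiffOn
      (fun m m' ↦ by simp [d.inl_injective.eq_iff]) hf hf'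
  · exact contDiffOn_lift_symm_trans_lift_self d.isOpenEmbedding_inl d.isOpenEmbedding_inr d.glue
      d.contMDiffOn_glue (fun a b ↦ d.inl_eq_inr_iff) hf hf'
  · exact contDiffOn_lift_symm_trans_lift_self d.isOpenEmbedding_inr d.isOpenEmbedding_inl
      d.glue.symm d.contMDiffOn_glue_symm (fun b a ↦ by
        rw [eq_comm, d.inl_eq_inr_iff]
        constructor
        · rintro ⟨ha, rfl⟩; exact ⟨d.glue.map_source ha, d.glue.left_inv ha⟩
        · rintro ⟨hb, rfl⟩; exact ⟨d.glue.map_target hb, d.glue.right_inv hb⟩) hf hf'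
  · exact contDiffOn_lift_symm_trans_lift_self d.isOpenEmbedding_inr d.isOpenEmbedding_inr
      (OpenPartialHomeomorph.refl B) contMDiff_id.contMDiffOn
      (fun m m' ↦ by simp [d.inr_injective.eq_iff]) hf hf'

/-! ### Smooth embeddings into the glued space -/

section Immersion

variable {F : Type*} [NormedAddCommGroup F] [NormedSpace ℝ F]
  {E_Q H_Q : Type*} [NormedAddCommGroup E_Q] [NormedSpace ℝ E_Q] [TopologicalSpace H_Q]
  {I_Q : ModelWithCorners ℝ E_Q H_Q} {Q : Type*} [TopologicalSpace Q] [ChartedSpace H_Q Q]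

/-- **`inl ∘ g` is an immersion where `g` is** (pieces with boundary). If `g : Q → A` is a `C^∞`
immersion at `q` with complement `F` (charts `φ`, `χ` in which `g` reads `u ↦ L (u, 0)`), then so
is `inl ∘ g : Q → A ∪ B`, with the lifted chart `chartAH χ`. [folklore] -/
theorem isImmersionAtOfComplement_inl_compH {g : Q → A} {q : Q}
    (hg : Manifold.IsImmersionAtOfComplement F I_Q (𝓡∂ (n + 1)) ∞ g q) :
    Manifold.IsImmersionAtOfComplement F I_Q (𝓡∂ (n + 1)) ∞ (d.inl ∘ g) q := by
  refine Manifold.IsImmersionAtOfComplement.mk_of_charts hg.equiv hg.domChart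
    (d.chartAH hg.codChart) hg.mem_domChart_source ?_ hg.domChart_mem_maximalAtlas
    (IsManifold.subset_maximalAtlas (d.chartAH_mem_atlas hg.codChart_mem_maximalAtlas)) ?_ ?_
  · exact ⟨_, hg.mem_codChart_source, rfl⟩
  · intro x hx
    exact ⟨_, hg.source_subset_preimage_source hx, rfl⟩
  · intro u hu
    have h := hg.writtenInCharts hu
    simp only [comp_apply, extend_coe] at h
    simp only [comp_apply, extend_coe, chartAH_apply_inl]
    rw [h]

/-- **`inr ∘ g` is an immersion where `g` is** (pieces with boundary). [folklore] -/
theorem isImmersionAtOfComplement_inr_compH {g : Q → B} {q : Q}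
    (hg : Manifold.IsImmersionAtOfComplement F I_Q (𝓡∂ (n + 1)) ∞ g q) :
    Manifold.IsImmersionAtOfComplement F I_Q (𝓡∂ (n + 1)) ∞ (d.inr ∘ g) q := by
  refine Manifold.IsImmersionAtOfComplement.mk_of_charts hg.equiv hg.domChart
    (d.chartBH hg.codChart) hg.mem_domChart_source ?_ hg.domChart_mem_maximalAtlas
    (IsManifold.subset_maximalAtlas (d.chartBH_mem_atlas hg.codChart_mem_maximalAtlas)) ?_ ?_
  · exact ⟨_, hg.mem_codChart_source, rfl⟩
  · intro x hx
    exact ⟨_, hg.source_subset_preimage_source hx, rfl⟩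
  · intro u hu
    have h := hg.writtenInCharts hu
    simp only [comp_apply, extend_coe] at h
    simp only [comp_apply, extend_coe, chartBH_apply_inr]
    rw [h]

/-- A smooth embedding into `A` composed with `inl` is a smooth embedding into the glued space
(pieces with boundary). [folklore] -/
theorem isSmoothEmbedding_inl_compH {g : Q → A}
    (hg : Manifold.IsSmoothEmbedding I_Q (𝓡∂ (n + 1)) ∞ g) :
    Manifold.IsSmoothEmbedding I_Q (𝓡∂ (n + 1)) ∞ (d.inl ∘ g) := by
  obtain ⟨⟨F', _, _, hF⟩, hemb⟩ := hg
  exact ⟨Manifold.IsImmersionOfComplement.isImmersion fun q ↦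
    d.isImmersionAtOfComplement_inl_compH (hF q), d.isOpenEmbedding_inl.isEmbedding.comp hemb⟩

/-- A smooth embedding into `B` composed with `inr` is a smooth embedding into the glued space
(pieces with boundary). [folklore] -/
theorem isSmoothEmbedding_inr_compH {g : Q → B}
    (hg : Manifold.IsSmoothEmbedding I_Q (𝓡∂ (n + 1)) ∞ g) :
    Manifold.IsSmoothEmbedding I_Q (𝓡∂ (n + 1)) ∞ (d.inr ∘ g) := by
  obtain ⟨⟨F', _, _, hF⟩, hemb⟩ := hg
  exact ⟨Manifold.IsImmersionOfComplement.isImmersion fun q ↦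
    d.isImmersionAtOfComplement_inr_compH (hF q), d.isOpenEmbedding_inr.isEmbedding.comp hemb⟩

/-- **`inl : A → A ∪ B` is a smooth embedding** (pieces with boundary; Kosinski, VI.1). [folklore] -/
theorem isSmoothEmbedding_inlH : Manifold.IsSmoothEmbedding (𝓡∂ (n + 1)) (𝓡∂ (n + 1)) ∞ d.inl :=
  d.isSmoothEmbedding_inl_compH Manifold.IsSmoothEmbedding.id

/-- **`inr : B → A ∪ B` is a smooth embedding** (pieces with boundary; Kosinski, VI.1). [folklore] -/
theorem isSmoothEmbedding_inrH : Manifold.IsSmoothEmbedding (𝓡∂ (n + 1)) (𝓡∂ (n + 1)) ∞ d.inr :=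
  d.isSmoothEmbedding_inr_compH Manifold.IsSmoothEmbedding.id

/-- `inl` is smooth (pieces with boundary). [folklore] -/
theorem contMDiff_inlH : ContMDiff (𝓡∂ (n + 1)) (𝓡∂ (n + 1)) ∞ d.inl :=
  d.isSmoothEmbedding_inlH.contMDiff

/-- `inr` is smooth (pieces with boundary). [folklore] -/
theorem contMDiff_inrH : ContMDiff (𝓡∂ (n + 1)) (𝓡∂ (n + 1)) ∞ d.inr :=
  d.isSmoothEmbedding_inrH.contMDiff

/-! ### The boundary of the glued manifold -/

/-- **Boundary points of the glued manifold, first piece**: `inl a` is a boundary point of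
`A ∪ B` iff `a` is a boundary point of `A` (read in the chart of `A` at `a` and its lift, which is
a chart of the glued space; invariance of the boundary, Lee (2013), Thm. 1.46). [folklore] -/
theorem isBoundaryPoint_inl_iff (a : A) :
    (𝓡∂ (n + 1)).IsBoundaryPoint (d.inl a) ↔ (𝓡∂ (n + 1)).IsBoundaryPoint a := by
  rw [← not_iff_not, ← ModelWithCorners.isInteriorPoint_iff_not_isBoundaryPoint,
    ← ModelWithCorners.isInteriorPoint_iff_not_isBoundaryPoint,
    (𝓡∂ (n + 1)).isInteriorPoint_iff_of_mem_atlas (n := ∞) (by simp)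
      (d.chartAH_mem_atlas (IsManifold.chart_mem_maximalAtlas a)) ⟨a, mem_chart_source _ a, rfl⟩,
    (𝓡∂ (n + 1)).isInteriorPoint_iff_of_mem_atlas (n := ∞) (by simp) (chart_mem_atlas _ a)
      (mem_chart_source _ a)]
  rw [chartAH, OpenPartialHomeomorph.extend_coe, OpenPartialHomeomorph.extend_coe,
    OpenPartialHomeomorph.extend_target, OpenPartialHomeomorph.extend_target,
    OpenPartialHomeomorph.lift_openEmbedding_target, comp_apply, comp_apply,
    OpenPartialHomeomorph.lift_openEmbedding_apply]

/-- **Boundary points of the glued manifold, second piece**: `inr b` is a boundary point of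
`A ∪ B` iff `b` is a boundary point of `B`. [folklore] -/
theorem isBoundaryPoint_inr_iff (b : B) :
    (𝓡∂ (n + 1)).IsBoundaryPoint (d.inr b) ↔ (𝓡∂ (n + 1)).IsBoundaryPoint b := by
  rw [← not_iff_not, ← ModelWithCorners.isInteriorPoint_iff_not_isBoundaryPoint,
    ← ModelWithCorners.isInteriorPoint_iff_not_isBoundaryPoint,
    (𝓡∂ (n + 1)).isInteriorPoint_iff_of_mem_atlas (n := ∞) (by simp)
      (d.chartBH_mem_atlas (IsManifold.chart_mem_maximalAtlas b)) ⟨b, mem_chart_source _ b, rfl⟩,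
    (𝓡∂ (n + 1)).isInteriorPoint_iff_of_mem_atlas (n := ∞) (by simp) (chart_mem_atlas _ b)
      (mem_chart_source _ b)]
  rw [chartBH, OpenPartialHomeomorph.extend_coe, OpenPartialHomeomorph.extend_coe,
    OpenPartialHomeomorph.extend_target, OpenPartialHomeomorph.extend_target,
    OpenPartialHomeomorph.lift_openEmbedding_target, comp_apply, comp_apply,
    OpenPartialHomeomorph.lift_openEmbedding_apply]

/-- **The boundary of the glued manifold is the union of the images of the boundaries of the
pieces.** [folklore] -/
theorem boundary_glued_eq :
    (𝓡∂ (n + 1)).boundary d.Glued =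
      d.inl '' (𝓡∂ (n + 1)).boundary A ∪ d.inr '' (𝓡∂ (n + 1)).boundary B := by
  ext p
  constructor
  · intro hp
    rcases d.exists_inl_or_inr p with ⟨a, rfl⟩ | ⟨b, rfl⟩
    · exact Or.inl ⟨a, (d.isBoundaryPoint_inl_iff a).1 hp, rfl⟩
    · exact Or.inr ⟨b, (d.isBoundaryPoint_inr_iff b).1 hp, rfl⟩
  · rintro (⟨a, ha, rfl⟩ | ⟨b, hb, rfl⟩)
    · exact (d.isBoundaryPoint_inl_iff a).2 ha
    · exact (d.isBoundaryPoint_inr_iff b).2 hb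

/-- A (σ-)compact glued space is second countable (it is a charted space over the second
countable half-space, covered by countably many charts). [folklore] -/
theorem secondCountableTopologyH [SigmaCompactSpace d.Glued] : SecondCountableTopology d.Glued :=
  haveI : SecondCountableTopology (ℍ (n + 1)) := TopologicalSpace.Subtype.secondCountableTopology _
  ChartedSpace.secondCountable_of_sigmaCompact (ℍ (n + 1)) d.Glued

end Immersion

end SmoothGlueData

end Literature.Topology.FourManifolds
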